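import Summits.ResolutionOfSingularities.ResolutionOfSingularities.Theorems.HilbertSamuelEliminationSigmaMaxModificationsCorridor3SigmaTameLowSncContact
import Literature.AlgebraicGeometry.Resolution.QuadraticTransformsStructure
import HarnessLib

/-!
# [OURS · L1 W4.2] TAME-LOW row T-L4 «SNC PHASE, lineage-local» — part 1b: regular branches and their order of contact under a
# quadratic transform of a two-dimensional regular local ring (the ring-level content of Stacks Lemma 54.15.3 = Tag 0BI7 for
# plane branches: the strict transform of a regular branch is transversal to the exceptional curve, and its contact with any
# other regular branch drops by exactly one)
# (cell res-hironaka, LADDER-RESOLUTION rung L; slot W4.2, crux chain w42 `SigmaMaxModificationsCorridor3` stmt-ResolutionOfSingularities-19249 /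
# crux `SigmaMaxModifications` stmt-…-18506; res-L1-w42-plan-1 RULING v3.14-48 (PD)(iv)/(PF) row T-L4 → res-L1-w42-stub-4 (gen 7);
# `--supports stmt-ResolutionOfSingularities-19249 --as helper`; consumers: res-D-pv-002 ((TL6) fuel), res-L1-type-o1 (`TameLowPrescription`),
# res-L1-s42-pv-2 (T-L5 board))

HONEST FRAMING.  OURS bookkeeping for the TAME-LOW tier (RULING v3.14-48): classical commutative algebra of quadratic transforms of
two-dimensional regular local rings (Zariski; Abhyankar 1956; Huneke–Swanson §14; the Stacks Project §54.15), in the `Subring K` /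
`IsQuadraticTransform` currency of `QuadraticTransforms*.lean` (the currency of rows T-L3 / T-L4(i)). Nothing here is a statement
of H. Hironaka's manuscript [Hironaka2017] (CANDIDATE, never a premise) nor of Cossart–Jannsen–Saito; no named fact is introduced or
consumed; every declaration is PROVED; no `def`. AI-written; weaker than expert review.

SETTING.  `R ⊆ R₁ ⊆ K` local subrings, `R₁` a quadratic transform of `R` (`IsQuadraticTransform R R₁`) lying in the chart of a
non-zero `x ∈ 𝔪_R` (`blowupRing R x = R[𝔪_R/x] ⊆ R₁`), so that `𝔪_R R₁ = x R₁` (`map_maximalIdeal_eq_span_chart`) and the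
strict transform of a REGULAR branch `g ∈ 𝔪_R ∖ 𝔪_R²` is `g/x ∈ R₁`. PROVED:

* `isUnit_div_of_eq_unit_mul_add` — if `g = α x + q`, `α` a unit, `q ∈ 𝔪_R²` («`g` tangent to `V(x)`», the case `(x, g) ≠ 𝔪_R` of
  part 1a `exists_eq_unit_mul_add_of_span_pair_ne`) then `g/x` is a UNIT of `R₁`: the strict transform misses the `x`-chart.
* **`maximalIdeal_eq_span_pair_div`** — if `𝔪_R = (x, g)` and `g/x ∈ 𝔪_{R₁}` then **`𝔪_{R₁} = (x, g/x)`** (for ANY quadratic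
  transform, no regularity needed: `R₁ = R[g/x]_Q` by the chart change `IsQuadraticTransform.eq_ofPrime_of_le`, and an element
  `r + (g/x) a₁` of `Q` has `r ∈ 𝔪_R = x`-multiples): the strict transform of a regular branch is a regular parameter TRANSVERSAL
  to the exceptional curve `V(x)`, and the point is rational over `R/𝔪_R` — Stacks 0BI7 (2).
* **`two_le_and_contactOrder_div_div`** — `R, R₁` two-dimensional regular, `𝔪_R = (x, f)`, `g ∈ 𝔪_R` with `contactOrder f g = n < ∞`;
  if both strict transforms `f/x`, `g/x` pass through `R₁` then `n ≥ 2` and `contactOrder (f/x) (g/x) = n − 1` in `R₁` (unit form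
  `g = a f + u xⁿ ⇒ g/x = a (f/x) + u xⁿ⁻¹` in the new frame `(x, f/x)`) — Stacks 0BI7 (3) for two regular branches, with equality;
  in particular TRANSVERSAL regular branches are separated by one blow-up.
* `contactOrder_div_chart_eq_one` — the exceptional branch `x` and the strict transform `f/x` are transversal (contact `1` both ways).

Part 2 (`…SigmaTameLowSncStep`) assembles these into the snc defect of a finite configuration of regular branches and its strict
lexicographic drop at a non-snc lineage point; part 3 the lineage statement.

References: The Stacks Project, Tag 0BI7 (Lemma 54.15.3) [StacksProject]; C. Huneke, I. Swanson (2006), §14.2 and proof of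
Thm. 14.5.2 [HunekeSwanson2006]; S. D. Cutkosky 2014 §2.1 [Cutkosky2014]; O. Zariski, P. Samuel II, App. 5 [ZariskiSamuel1960].
-/

noncomputable section

set_option linter.dupNamespace false -- mandated namespace of this single-conjunct summit

open IsLocalRing Literature.AlgebraicGeometry.Resolution

namespace Summit.ResolutionOfSingularities.ResolutionOfSingularities.Theorems.SigmaMaxModificationsCorridor3.TameLowSnc

universe u

/-! ## §4 Regular branches under a quadratic transform `R ⊆ R[𝔪/x] ⊆ R₁` with `R₁` again local (a point of the exceptional curve) -/

section Transform

variable {K : Type u} [Field K] {R R₁ : Subring K} [IsLocalRing R] [IsLocalRing R₁]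

omit [IsLocalRing R₁] in
/-- For `y ∈ 𝔪_R` and the chart element `x` (`R[𝔪/x] ⊆ R₁`): `y/x ∈ R₁`. [OURS · proved] -/
theorem div_mem_of_mem_maximalIdeal {x : R} (hT : blowupRing R (x : K) ≤ R₁) {y : R} (hy : y ∈ maximalIdeal R) :
    ((y : R) : K) / x ∈ R₁ :=
  hT (div_mem_blowupRing _ hy)

omit [IsLocalRing R₁] in
/-- **`𝔪_R R₁ = x R₁`** for a non-zero chart element `x ∈ 𝔪_R` with `R[𝔪/x] ⊆ R₁` (`y = (y/x)·x`). [OURS · proved; Cutkosky §2.1] -/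
theorem map_maximalIdeal_eq_span_chart {x : R} (hx : x ∈ maximalIdeal R) (hx0 : x ≠ 0)
    (hT : blowupRing R (x : K) ≤ R₁) (hRle : R ≤ R₁) :
    (maximalIdeal R).map (Subring.inclusion hRle) = Ideal.span {Subring.inclusion hRle x} := by
  have hx0K : ((x : R) : K) ≠ 0 := fun e => hx0 (Subtype.ext e)
  apply le_antisymm
  · rw [Ideal.map_le_iff_le_comap]
    intro y hy
    rw [Ideal.mem_comap, Ideal.mem_span_singleton']
    refine ⟨⟨_, div_mem_of_mem_maximalIdeal hT hy⟩, Subtype.ext ?_⟩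
    change (y : K) / x * (x : K) = (y : K)
    rw [div_mul_cancel₀ _ hx0K]
  · rw [Ideal.span_singleton_le_iff_mem]
    exact Ideal.mem_map_of_mem _ hx

omit [IsLocalRing R₁] in
/-- Elements of `𝔪_R` lie in `x R₁ ⊆ 𝔪_{R₁}`: `y = x · (y/x)` in `R₁`. [OURS · proved] -/
theorem inclusion_eq_chart_mul_div {x : R} (hx0 : x ≠ 0) (hT : blowupRing R (x : K) ≤ R₁) (hRle : R ≤ R₁)
    {y : R} (hy : y ∈ maximalIdeal R) :
    Subring.inclusion hRle y = Subring.inclusion hRle x * ⟨_, div_mem_of_mem_maximalIdeal hT hy⟩ := by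
  have hx0K : ((x : R) : K) ≠ 0 := fun e => hx0 (Subtype.ext e)
  apply Subtype.ext
  change (y : K) = (x : K) * ((y : K) / x)
  rw [mul_div_cancel₀ _ hx0K]

/-- **The strict transform of a branch tangent to `V(x)` misses the `x`-chart**: if `g = α x + q` with `α` a unit of `R` and
`q ∈ 𝔪²`, then `g/x = α + q/x` with `q/x ∈ x R₁ ⊆ 𝔪_{R₁}`, a unit of `R₁` (for `R₁` dominating `R`). [OURS · proved] -/
theorem isUnit_div_of_eq_unit_mul_add {x : R} (hx0 : x ≠ 0)
    (hT : blowupRing R (x : K) ≤ R₁) (hdom : SubringDominates R R₁) {g α q : R} (hα : IsUnit α)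
    (hq : q ∈ maximalIdeal R ^ 2) (hg : g = α * x + q) (hgm : g ∈ maximalIdeal R) :
    IsUnit (⟨((g : R) : K) / x, div_mem_of_mem_maximalIdeal hT hgm⟩ : R₁) := by
  have hRle : R ≤ R₁ := hdom.1
  have hx0K : ((x : R) : K) ≠ 0 := fun e => hx0 (Subtype.ext e)
  -- `q = Σ aᵢ bᵢ`, so `q/x ∈ 𝔪_R · R₁`-multiples… : directly, `q ∈ 𝔪·𝔪` gives `q/x ∈ 𝔪_{R₁}`
  have hqx : ∀ q ∈ maximalIdeal R ^ 2, ∃ hq' : ((q : R) : K) / x ∈ R₁, (⟨_, hq'⟩ : R₁) ∈ maximalIdeal R₁ := by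
    intro q hq
    rw [pow_two] at hq
    refine Submodule.smul_induction_on (p := fun q => ∃ hq' : ((q : R) : K) / x ∈ R₁, (⟨_, hq'⟩ : R₁) ∈ maximalIdeal R₁)
      hq ?_ ?_
    · intro a ha b hb
      have hbx : ((b : R) : K) / x ∈ R₁ := div_mem_of_mem_maximalIdeal hT hb
      have hmem : (((a • b : R) : R) : K) / x ∈ R₁ := by
        rw [smul_eq_mul, Subring.coe_mul, mul_div_assoc]
        exact R₁.mul_mem (hRle a.2) hbx
      refine ⟨hmem, ?_⟩
      have e : (⟨_, hmem⟩ : R₁) = Subring.inclusion hRle a * ⟨_, hbx⟩ := Subtype.ext (by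
        change (((a • b : R) : R) : K) / x = (a : K) * ((b : K) / x)
        rw [smul_eq_mul, Subring.coe_mul, mul_div_assoc])
      rw [e]
      exact Ideal.mul_mem_right _ _ ((incl_mem_maximalIdeal_iff hdom a).mpr ha)
    · rintro a b ⟨ha, ham⟩ ⟨hb, hbm⟩
      have hmem : (((a + b : R) : R) : K) / x ∈ R₁ := by
        rw [Subring.coe_add, add_div]; exact R₁.add_mem ha hb
      refine ⟨hmem, ?_⟩
      have e : (⟨_, hmem⟩ : R₁) = ⟨_, ha⟩ + ⟨_, hb⟩ := Subtype.ext (by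
        change (((a + b : R) : R) : K) / x = (a : K) / x + (b : K) / x
        rw [Subring.coe_add, add_div])
      rw [e]; exact Ideal.add_mem _ ham hbm
  obtain ⟨hq', hqm⟩ := hqx q hq
  -- `g/x = α + q/x`
  have e : (⟨((g : R) : K) / x, div_mem_of_mem_maximalIdeal hT hgm⟩ : R₁) = Subring.inclusion hRle α + ⟨_, hq'⟩ :=
    Subtype.ext (by
      change ((g : R) : K) / x = (α : K) + (q : K) / x
      rw [hg, Subring.coe_add, Subring.coe_mul, add_div, mul_div_cancel_right₀ _ hx0K])
  rw [e]
  -- unit + element of `𝔪_{R₁}` is a unit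
  have hαu : IsUnit (Subring.inclusion hRle α) := hα.map _
  by_contra hnu
  have h1 : Subring.inclusion hRle α + ⟨_, hq'⟩ ∈ maximalIdeal R₁ := (mem_maximalIdeal _).mpr hnu
  have h2 : Subring.inclusion hRle α ∈ maximalIdeal R₁ := by
    have := Ideal.sub_mem _ h1 hqm
    rwa [add_sub_cancel_right] at this
  exact (mem_maximalIdeal _).mp h2 hαu

/-- Every element of `R[u]` is `r + u · a₁` with `r ∈ R`, `a₁ ∈ R[u]` (write it as `F(u)`, `F = F(0) + X · F.divX`).
[folklore] -/
theorem exists_eq_add_mul_of_mem_adjoin (R : Subring K) (u : K) {a : K} (ha : a ∈ (Algebra.adjoin R {u}).toSubring) :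
    ∃ r : R, ∃ a₁ ∈ (Algebra.adjoin R {u}).toSubring, a = (r : K) + u * a₁ := by
  obtain ⟨F, hF⟩ := exists_aeval_eq_of_mem_adjoin ha
  refine ⟨F.coeff 0, Polynomial.aeval u F.divX, Polynomial.aeval_mem_adjoin_singleton R u, ?_⟩
  have e : Polynomial.aeval u F = Polynomial.aeval u (Polynomial.X * F.divX + Polynomial.C (F.coeff 0)) := by
    rw [Polynomial.X_mul_divX_add]
  rw [← hF, e, map_add, map_mul, Polynomial.aeval_X, Polynomial.aeval_C, add_comm]
  rfl

/-- **The strict transform of a regular branch transversal to `V(x)` is transversal to the exceptional curve** (the ring-level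
content of Stacks Tag 0BI7 (2)): let `R₁` be a quadratic transform of the local ring `R ⊆ K`, `𝔪_R = (x, g)` with `x ≠ 0` and
`R[𝔪_R/x] ⊆ R₁`; if the strict transform `g/x` lies in `𝔪_{R₁}` then **`𝔪_{R₁} = (x, g/x)`**. Proof: `R₁` is the localisation
of `A = R[g/x]` at `Q = 𝔪_{R₁} ∩ A` (chart change); every `a ∈ A` is `r + (g/x)·a₁` with `r ∈ R`, and `a ∈ Q` forces
`r ∈ 𝔪_R = ` the `x`-multiples. [OURS · proved; The Stacks Project Tag 0BI7 (2)] -/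
theorem maximalIdeal_eq_span_pair_div (hq : IsQuadraticTransform R R₁) {x g : R}
    (hm : maximalIdeal R = Ideal.span {x, g}) (hx0 : x ≠ 0) (hT : blowupRing R (x : K) ≤ R₁)
    (hgx : ((g : R) : K) / x ∈ R₁) (hgx₁ : (⟨((g : R) : K) / x, hgx⟩ : R₁) ∈ maximalIdeal R₁) :
    maximalIdeal R₁ = Ideal.span {Subring.inclusion hq.dominates.1 x, ⟨((g : R) : K) / x, hgx⟩} := by
  have hdom := hq.dominates
  have hRle : R ≤ R₁ := hdom.1
  have hx : x ∈ maximalIdeal R := hm ▸ Ideal.subset_span (by simp)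
  have hx0K : ((x : R) : K) ≠ 0 := fun e => hx0 (Subtype.ext e)
  have hA : blowupRing R (x : K) = (Algebra.adjoin R {((g : R) : K) / ((x : R) : K)}).toSubring :=
    blowupRing_eq_adjoin hm
  have hAle : (Algebra.adjoin R {((g : R) : K) / ((x : R) : K)}).toSubring ≤ R₁ := hA.ge.trans hT
  have hR₁ : R₁ = (LocalSubring.ofPrime _ ((maximalIdeal R₁).comap (Subring.inclusion hAle))).toSubring :=
    hq.eq_ofPrime_of_le hx hx0 hA.le hAle
  have hxm₁ : Subring.inclusion hRle x ∈ maximalIdeal R₁ := (incl_mem_maximalIdeal_iff hdom x).mpr hx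
  refine le_antisymm (fun z hz => ?_) (span_pair_le_iff.mpr ⟨hxm₁, hgx₁⟩)
  obtain ⟨a, s, hs, hzas⟩ := mem_ofPrime_iff.mp (hR₁.le z.2)
  have hsR₁ : (s : K) ∈ R₁ := hAle s.2
  have haR₁ : (a : K) ∈ R₁ := hAle a.2
  have hs0 : ((s : _) : K) ≠ 0 := coe_ne_zero_of_not_mem hs
  -- `s` is a unit of `R₁`
  have hsunit : IsUnit (⟨(s : K), hsR₁⟩ : R₁) := by
    by_contra hns
    exact hs ((mem_maximalIdeal _).mpr hns)
  -- `a = z s ∈ 𝔪_{R₁}`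
  have hza : z * ⟨(s : K), hsR₁⟩ = ⟨(a : K), haR₁⟩ := Subtype.ext (by
    change (z : K) * (s : K) = (a : K)
    rw [hzas, div_mul_cancel₀ _ hs0])
  have ham : (⟨(a : K), haR₁⟩ : R₁) ∈ maximalIdeal R₁ := hza ▸ Ideal.mul_mem_right _ _ hz
  -- `a = r + u a₁`
  obtain ⟨r, a₁, ha₁, hra⟩ := exists_eq_add_mul_of_mem_adjoin R _ a.2
  have ha₁R₁ : a₁ ∈ R₁ := hAle ha₁
  -- `r ∈ 𝔪_R`
  have hrm : r ∈ maximalIdeal R := by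
    have e : Subring.inclusion hRle r = ⟨(a : K), haR₁⟩ - ⟨_, hgx⟩ * ⟨a₁, ha₁R₁⟩ := Subtype.ext (by
      change (r : K) = (a : K) - ((g : R) : K) / x * a₁
      rw [hra, add_sub_cancel_right])
    have h : Subring.inclusion hRle r ∈ maximalIdeal R₁ := by
      rw [e]; exact Ideal.sub_mem _ ham (Ideal.mul_mem_right _ _ hgx₁)
    exact (incl_mem_maximalIdeal_iff hdom r).mp h
  -- so `a = x (r/x) + u a₁ ∈ (x, u)` and `z = a s⁻¹ ∈ (x, u)`
  have haN : (⟨(a : K), haR₁⟩ : R₁) ∈ Ideal.span {Subring.inclusion hRle x, ⟨((g : R) : K) / x, hgx⟩} := by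
    have e : (⟨(a : K), haR₁⟩ : R₁) =
        Subring.inclusion hRle x * ⟨_, div_mem_of_mem_maximalIdeal hT hrm⟩ + ⟨_, hgx⟩ * ⟨a₁, ha₁R₁⟩ :=
      Subtype.ext (by
        change (a : K) = (x : K) * ((r : K) / x) + ((g : R) : K) / x * a₁
        rw [mul_div_cancel₀ _ hx0K, hra])
    rw [e]
    exact Ideal.add_mem _ (Ideal.mul_mem_right _ _ (Ideal.subset_span (by simp)))
      (Ideal.mul_mem_right _ _ (Ideal.subset_span (by simp)))
  obtain ⟨w, hw⟩ := hsunit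
  have e : z = ⟨(a : K), haR₁⟩ * ↑w⁻¹ := by
    rw [← hza, ← hw, mul_assoc, Units.mul_inv, mul_one]
  rw [e]
  exact Ideal.mul_mem_right _ _ haN

end Transform

section TransformRegular

variable {K : Type u} [Field K] {R R₁ : Subring K}

/-- **Contact drops by exactly one under the blow-up** (the ring-level content of Stacks Tag 0BI7 (3) for two regular
branches, with equality): `R ⊆ R₁` two-dimensional regular local rings of `K`, `R₁` a quadratic transform of `R` in the chart of
`x`, `𝔪_R = (x, f)`; if the strict transforms `f/x` and `g/x` of the regular branch `f` and of a branch `g ∈ 𝔪_R` with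
`contactOrder f g = n < ∞` both pass through `R₁`, then **`n ≥ 2` and `contactOrder (f/x) (g/x) = n − 1`** in `R₁`
(`g = a f + u xⁿ` gives `g/x = a (f/x) + u xⁿ⁻¹`, and `𝔪_{R₁} = (x, f/x)`). In particular the strict transforms of two
TRANSVERSAL regular branches (`n = 1`) never pass through the same point. [OURS · proved; The Stacks Project Tag 0BI7 (3)] -/
theorem two_le_and_contactOrder_div_div [IsRegularLocalRing R] [IsRegularLocalRing R₁] (hdim : ringKrullDim R = 2)
    (hdim₁ : ringKrullDim R₁ = 2) (hq : IsQuadraticTransform R R₁) {x f g : R}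
    (hm : maximalIdeal R = Ideal.span {x, f}) (hx0 : x ≠ 0) (hT : blowupRing R (x : K) ≤ R₁)
    (hfx : ((f : R) : K) / x ∈ R₁) (hfx₁ : (⟨((f : R) : K) / x, hfx⟩ : R₁) ∈ maximalIdeal R₁)
    (hgx : ((g : R) : K) / x ∈ R₁) (hgx₁ : (⟨((g : R) : K) / x, hgx⟩ : R₁) ∈ maximalIdeal R₁)
    {n : ℕ} (hn : contactOrder f g = n) :
    2 ≤ n ∧ contactOrder (⟨((f : R) : K) / x, hfx⟩ : R₁) ⟨((g : R) : K) / x, hgx⟩ = (n - 1 : ℕ) := by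
  have hdom := hq.dominates
  have hRle : R ≤ R₁ := hdom.1
  have hx0K : ((x : R) : K) ≠ 0 := fun e => hx0 (Subtype.ext e)
  obtain ⟨hfp, hfnx, -, -⟩ := prime_and_not_dvd_of_span_pair hdim hm
  obtain ⟨a, u, hu, hg⟩ := (contactOrder_eq_coe_iff_exists hm hfp hfnx g n).mp hn
  -- the new frame `𝔪_{R₁} = (x, f/x)`
  have hm₁ := maximalIdeal_eq_span_pair_div hq hm hx0 hT hfx hfx₁
  obtain ⟨hfp₁, hfnx₁, -, -⟩ := prime_and_not_dvd_of_span_pair hdim₁ hm₁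
  have hxm₁ : Subring.inclusion hRle x ∈ maximalIdeal R₁ := hm₁ ▸ Ideal.subset_span (by simp)
  -- `n ≥ 1`: else `g = a f + u` is a unit… but `g/x ∈ 𝔪_{R₁}` needs `g ∈ 𝔪`; we get `n ≠ 0` from the computation below
  cases n with
  | zero =>
    -- `g = a f + u`, so `g/x · x = a f + u`: `u = g - a f`, and `g/x ∈ 𝔪₁`, `f = x (f/x) ∈ 𝔪₁`-multiples ⇒ `u ∈ 𝔪₁`
    exfalso
    have e : Subring.inclusion hRle u =
        Subring.inclusion hRle x * (⟨_, hgx⟩ - Subring.inclusion hRle a * ⟨_, hfx⟩) := Subtype.ext (by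
      change (u : K) = (x : K) * ((g : K) / x - (a : K) * ((f : K) / x))
      rw [mul_sub, mul_div_cancel₀ _ hx0K, ← mul_assoc, mul_comm (x : K) (a : K), mul_assoc,
        mul_div_cancel₀ _ hx0K, hg, pow_zero, mul_one, Subring.coe_add, Subring.coe_mul, add_sub_cancel_left])
    have hum : Subring.inclusion hRle u ∈ maximalIdeal R₁ := by rw [e]; exact Ideal.mul_mem_right _ _ hxm₁
    exact (mem_maximalIdeal _).mp ((incl_mem_maximalIdeal_iff hdom u).mp hum) hu
  | succ m =>
    -- `g/x = a (f/x) + u x^m`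
    have e : (⟨((g : R) : K) / x, hgx⟩ : R₁) =
        Subring.inclusion hRle a * ⟨_, hfx⟩ + Subring.inclusion hRle u * Subring.inclusion hRle x ^ m :=
      Subtype.ext (by
        change (g : K) / x = (a : K) * ((f : K) / x) + (u : K) * (x : K) ^ m
        rw [hg, Subring.coe_add, Subring.coe_mul, Subring.coe_mul, Subring.coe_pow, add_div, mul_div_assoc,
          pow_succ, ← mul_assoc, mul_div_cancel_right₀ _ hx0K])
    have hu₁ : IsUnit (Subring.inclusion hRle u) := hu.map _
    have hcontact : contactOrder (⟨((f : R) : K) / x, hfx⟩ : R₁) ⟨((g : R) : K) / x, hgx⟩ = m := by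
      rw [e]; exact contactOrder_add_mul_pow hm₁ hfp₁ hfnx₁ _ hu₁ m
    refine ⟨?_, by simpa using hcontact⟩
    -- `m ≥ 1`: if `m = 0` then `u = g/x - a (f/x) ∈ 𝔪₁`
    cases m with
    | zero =>
      exfalso
      have hum : Subring.inclusion hRle u ∈ maximalIdeal R₁ := by
        have e' : Subring.inclusion hRle u = ⟨((g : R) : K) / x, hgx⟩ - Subring.inclusion hRle a * ⟨_, hfx⟩ := by
          rw [e, pow_zero, mul_one, add_sub_cancel_left]
        rw [e']; exact Ideal.sub_mem _ hgx₁ (Ideal.mul_mem_left _ _ hfx₁)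
      exact (mem_maximalIdeal _).mp hum hu₁
    | succ k => omega

/-- The exceptional branch is transversal to the strict transform: with `𝔪_{R₁} = (x, f/x)` as above,
`contactOrder (f/x) x = 1` and `contactOrder x (f/x) = 1` in `R₁`. [OURS · proved; The Stacks Project Tag 0BI7 (2)] -/
theorem contactOrder_div_chart_eq_one [IsLocalRing R] [IsRegularLocalRing R₁] (hdim₁ : ringKrullDim R₁ = 2)
    (hq : IsQuadraticTransform R R₁) {x f : R} (hm : maximalIdeal R = Ideal.span {x, f}) (hx0 : x ≠ 0)
    (hT : blowupRing R (x : K) ≤ R₁) (hfx : ((f : R) : K) / x ∈ R₁)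
    (hfx₁ : (⟨((f : R) : K) / x, hfx⟩ : R₁) ∈ maximalIdeal R₁) :
    contactOrder (⟨((f : R) : K) / x, hfx⟩ : R₁) (Subring.inclusion hq.dominates.1 x) = 1 ∧
      contactOrder (Subring.inclusion hq.dominates.1 x) (⟨((f : R) : K) / x, hfx⟩ : R₁) = 1 := by
  have hm₁ := maximalIdeal_eq_span_pair_div hq hm hx0 hT hfx hfx₁
  have hm₁' : maximalIdeal R₁ = Ideal.span {⟨((f : R) : K) / x, hfx⟩, Subring.inclusion hq.dominates.1 x} := by
    rw [hm₁, Ideal.span_pair_comm]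
  obtain ⟨hfp₁, hfnx₁, -, -⟩ := prime_and_not_dvd_of_span_pair hdim₁ hm₁
  obtain ⟨hxp₁, hxnf₁, -, -⟩ := prime_and_not_dvd_of_span_pair hdim₁ hm₁'
  exact ⟨contactOrder_self_right_eq_one hm₁ hfp₁ hfnx₁, contactOrder_self_right_eq_one hm₁' hxp₁ hxnf₁⟩

end TransformRegular

end Summit.ResolutionOfSingularities.ResolutionOfSingularities.Theorems.SigmaMaxModificationsCorridor3.TameLowSnc

end
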